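import Mathlib
import HarnessLib
import Summits.HubbardSuperconductivity.HubbardSuperconductivity.Theorems.KLProgrammeKLRegimeSplitPhRotationAngularWeight
import Summits.HubbardSuperconductivity.HubbardSuperconductivity.Theorems.KLProgrammeKLRegimeSplitPhRotationArgLipschitz
import Summits.HubbardSuperconductivity.HubbardSuperconductivity.Theorems.KLProgrammePlanarPeriodization

/-!
# Route `KLProgramme` — ENGINE (stmt-HubbardSuperconductivity-20437 `KLRegimeEngineV17F2`), row (c) binder #8 (★ v19 `hexLadMV`), value rows `RP/RQ`, brick O6i-d (part 3):
# THE PLANAR EXTENSION OF AN ANGULAR PROFILE — for a `2π`-periodic, Lipschitz, bounded `V(ϑ)` there is a planar weight `w` that is continuous, doubly `2π`-periodic,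
# Lipschitz with an EXPLICIT constant, bounded by `B_V`, and RADIALLY CONSTANT on the chart tube (`w(levelChart(ρ,ϑ)) = V(ϑ)`) — i.e. ALL the weight hypotheses of
# O6i-a/b/c (`klpw_planar/lattice_rotation_weighted_le`, `klpw_phValue_row_weighted_le`) from the profile alone
# (cell gate-hubbard-kl, seat hubbard-kl-k3c2-p2 g32, technique «thermal-bar induction n ≤ nScales β + 1 with EngineBoundsAtV4S sums»)

CONSTRUCTION.  `w = klfl_periodize g`, `g(q) = V(arg(q₁ + iq₂))·ψ(‖q₁ + iq₂‖)` with the radial plateau `ψ(ρ) = clamp((2ρ − u₀)/u₀)·clamp((R₂ − ρ)/(R₂ − R₁))`,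
`clamp = min 1 ∘ max 0`: `ψ = 0` for `ρ ≤ u₀/2` (origin) and `ρ ≥ R₂` (square boundary, `R₂ < π`), `ψ = 1` on `[u₀, R₁] ∋` the tube's radii.  Lipschitz constant of `g`
(sup metric): `L_g = 2·(L_V·(π/(u₀/2)) + B_V·(2/u₀ + 1/(R₂ − R₁)))` (O6i-d part 2 `klpw_abs_comp_arg_sub_le` away from the origin; near the origin `g` vanishes linearly);
of `w`: `L_g + 2B_V/(π − R₂)` (`klfl_periodize_lipschitz`).

* **`klpw_angularWeight_exists`** — the existence statement with these constants, under the chart data and the tube-radius hypothesis `u₀ ≤ u_K(μ+ρ,ϑ) ≤ R₁` (`|ρ| < r`).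
Pure real analysis; no definitions (the weight is exhibited inside the proof); nothing asserts (c), K3 or superconductivity.  [folklore]
-/

noncomputable section

namespace Summit.HubbardSuperconductivity.HubbardSuperconductivity.Theorems.KLRegimeSplit

set_option linter.dupNamespace false -- summit = problem name (single-conjunct summit), D-0017

open Real Set Literature.MathematicalPhysics.QuantumLattice Literature.Probability.LatticeModels
open Literature.MathematicalPhysics.QuantumLattice.BandSectorCounting
open Summit.HubbardSuperconductivity.HubbardSuperconductivity.Theorems.TwoPointAssembly
open Summit.HubbardSuperconductivity.HubbardSuperconductivity.Theorems.EngineV8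
open Summit.HubbardSuperconductivity.HubbardSuperconductivity.Theorems.DispersionFlow
open Summit.HubbardSuperconductivity.HubbardSuperconductivity.Theorems.PerturbedFermiCurve
open Summit.HubbardSuperconductivity.HubbardSuperconductivity.Theorems.C4a

/-! ## §1 Small real-analysis facts: the clamp, the planar point as a complex number -/

/-- The clamp `min 1 (max 0 x)` is `1`-Lipschitz. -/
private theorem klpw_clamp_sub_le (x y : ℝ) : |min 1 (max 0 x) - min 1 (max 0 y)| ≤ |x - y| := by
  calc |min 1 (max 0 x) - min 1 (max 0 y)| ≤ max |(1 : ℝ) - 1| |max 0 x - max 0 y| := abs_min_sub_min_le_max _ _ _ _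
    _ = |max 0 x - max 0 y| := by rw [sub_self, abs_zero, max_eq_right (abs_nonneg _)]
    _ = |max x 0 - max y 0| := by rw [max_comm 0 x, max_comm 0 y]
    _ ≤ |x - y| := abs_max_sub_max_le_abs _ _ _

/-- The clamp takes values in `[0, 1]`. -/
private theorem klpw_clamp_mem (x : ℝ) : 0 ≤ min 1 (max 0 x) ∧ min 1 (max 0 x) ≤ 1 :=
  ⟨le_min zero_le_one (le_max_left _ _), min_le_left _ _⟩

/-- `‖(a : ℂ) + b·I‖`: real and imaginary parts. -/
private theorem klpw_zc_re_im (a b : ℝ) : ((a : ℂ) + (b : ℂ) * Complex.I).re = a ∧ ((a : ℂ) + (b : ℂ) * Complex.I).im = b := by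
  constructor <;> simp

/-- `|a| ≤ ‖a + bI‖`. -/
private theorem klpw_abs_fst_le_norm (a b : ℝ) : |a| ≤ ‖(a : ℂ) + (b : ℂ) * Complex.I‖ := by
  have h := Complex.abs_re_le_norm ((a : ℂ) + (b : ℂ) * Complex.I)
  rwa [(klpw_zc_re_im a b).1] at h

/-- The sup distance controls the complex distance: `‖(p₁ + ip₂) − (q₁ + iq₂)‖ ≤ 2·dist p q`. -/
private theorem klpw_norm_zc_sub_le (p q : ℝ × ℝ) :
    ‖((p.1 : ℂ) + (p.2 : ℂ) * Complex.I) - ((q.1 : ℂ) + (q.2 : ℂ) * Complex.I)‖ ≤ 2 * dist p q := by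
  have e : ((p.1 : ℂ) + (p.2 : ℂ) * Complex.I) - ((q.1 : ℂ) + (q.2 : ℂ) * Complex.I) = ((p.1 - q.1 : ℝ) : ℂ) + ((p.2 - q.2 : ℝ) : ℂ) * Complex.I := by
    push_cast; ring
  rw [e]
  calc ‖((p.1 - q.1 : ℝ) : ℂ) + ((p.2 - q.2 : ℝ) : ℂ) * Complex.I‖ ≤ ‖((p.1 - q.1 : ℝ) : ℂ)‖ + ‖((p.2 - q.2 : ℝ) : ℂ) * Complex.I‖ := norm_add_le _ _
    _ = |p.1 - q.1| + |p.2 - q.2| := by rw [norm_mul, Complex.norm_I, mul_one, Complex.norm_real, Complex.norm_real, Real.norm_eq_abs, Real.norm_eq_abs]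
    _ ≤ dist p q + dist p q := add_le_add (by rw [← Real.dist_eq, Prod.dist_eq]; exact le_max_left _ _)
        (by rw [← Real.dist_eq, Prod.dist_eq]; exact le_max_right _ _)
    _ = 2 * dist p q := by ring

/-- The chart point as a complex number: `u·e^{iϑ}`, of norm `u` (`u > 0`). -/
private theorem klpw_norm_zc_levelChart {μ : ℝ} {K : TrigPolyC4v} (p : ℝ × ℝ) (hu : 0 < perturbedFermiRadius (fun k : Fin 2 → ℝ => -K.eval k) (μ + p.1) p.2) :
    ‖(((levelChart μ K p).1 : ℂ) + ((levelChart μ K p).2 : ℂ) * Complex.I)‖ = perturbedFermiRadius (fun k : Fin 2 → ℝ => -K.eval k) (μ + p.1) p.2 := by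
  rw [levelChart_apply]
  simp only
  have hz : (((perturbedFermiRadius (fun k : Fin 2 → ℝ => -K.eval k) (μ + p.1) p.2 * Real.cos p.2 : ℝ)) : ℂ) +
      (((perturbedFermiRadius (fun k : Fin 2 → ℝ => -K.eval k) (μ + p.1) p.2 * Real.sin p.2 : ℝ)) : ℂ) * Complex.I =
      ((perturbedFermiRadius (fun k : Fin 2 → ℝ => -K.eval k) (μ + p.1) p.2 : ℝ) : ℂ) * Complex.exp ((p.2 : ℂ) * Complex.I) := by
    rw [Complex.exp_mul_I]; push_cast; ring
  rw [hz, norm_mul, Complex.norm_real, Complex.norm_exp_ofReal_mul_I, mul_one, Real.norm_of_nonneg hu.le]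

/-! ## §2 The existence of the planar weight -/

section Extension

variable {a b : ℝ} (B : BandBounds a b) {K : TrigPolyC4v} {A : ℝ}
  (hA : ∀ p : Momentum, ∀ j ≤ 2, ‖iteratedFDeriv ℝ j (frameShift K) p‖ ≤ A)
  {μ r : ℝ} (hlo : a < μ - r - A) (hhi : μ + r + A < b)
include B hA hlo hhi

/-- **THE PLANAR EXTENSION OF AN ANGULAR PROFILE.**  For `V : ℝ → ℝ` `2π`-periodic, `L_V`-Lipschitz, `|V| ≤ B_V`, radii `0 < u₀ ≤ R₁ < R₂ < π` with the tube's radii in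
`[u₀, R₁]` (`u₀ ≤ u_K(μ+ρ,ϑ) ≤ R₁` for `|ρ| < r`), there is a planar weight `w` with: `w` continuous; doubly `2π`-periodic; `|w p − w q| ≤ L_w·dist p q` with
`L_w = 2(L_V(π/(u₀/2)) + B_V(2/u₀ + 1/(R₂ − R₁))) + 2B_V/(π − R₂)`; `|w| ≤ B_V`; and `w(levelChart μ K p) = V p.2` for `p.1 ∈ (−r, r)` — the hypotheses `hwc hw1 hw2 hwlip hwb hw`
of `klpw_lattice_rotation_weighted_le` / `klpw_phValue_row_weighted_le` (with `v = V`). [folklore] -/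
theorem klpw_angularWeight_exists (V : ℝ → ℝ) (hV : Function.Periodic V (2 * π)) {LV : ℝ} (hLV : 0 ≤ LV) (hVlip : ∀ a b, |V a - V b| ≤ LV * |a - b|)
    {BV : ℝ} (hVbd : ∀ ϑ, |V ϑ| ≤ BV) {u₀ R₁ R₂ : ℝ} (hu₀ : 0 < u₀) (hR₁ : u₀ ≤ R₁) (hR₁₂ : R₁ < R₂) (hR₂ : R₂ < π)
    (hrad : ∀ p : ℝ × ℝ, p.1 ∈ Ioo (-r) r →
      u₀ ≤ perturbedFermiRadius (fun k : Fin 2 → ℝ => -K.eval k) (μ + p.1) p.2 ∧ perturbedFermiRadius (fun k : Fin 2 → ℝ => -K.eval k) (μ + p.1) p.2 ≤ R₁) :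
    ∃ w : ℝ × ℝ → ℝ, Continuous w ∧ (∀ x y, w (x + 2 * π, y) = w (x, y)) ∧ (∀ x y, w (x, y + 2 * π) = w (x, y)) ∧
      (∀ p q : ℝ × ℝ, |w p - w q| ≤ (2 * (LV * (π / (u₀ / 2)) + BV * (2 / u₀ + 1 / (R₂ - R₁))) + 2 * BV / (π - R₂)) * dist p q) ∧
      (∀ p, |w p| ≤ BV) ∧ (∀ p : ℝ × ℝ, p.1 ∈ Ioo (-r) r → w (levelChart μ K p) = V p.2) := by
  have hπ := Real.pi_pos
  have hBV : 0 ≤ BV := (abs_nonneg _).trans (hVbd 0)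
  have hR0 : 0 < R₂ - R₁ := by linarith
  have hzm : 0 < π - R₂ := by linarith
  -- the radial plateau and the raw weight
  set ψ : ℝ → ℝ := fun ρ => min 1 (max 0 ((2 * ρ - u₀) / u₀)) * min 1 (max 0 ((R₂ - ρ) / (R₂ - R₁))) with hψ
  set zc : ℝ × ℝ → ℂ := fun q => (q.1 : ℂ) + (q.2 : ℂ) * Complex.I with hzc
  set g : ℝ × ℝ → ℝ := fun q => V (Complex.arg (zc q)) * ψ ‖zc q‖ with hg
  -- plateau facts
  have hψ01 : ∀ ρ, 0 ≤ ψ ρ ∧ ψ ρ ≤ 1 := fun ρ => by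
    have h1 := klpw_clamp_mem ((2 * ρ - u₀) / u₀)
    have h2 := klpw_clamp_mem ((R₂ - ρ) / (R₂ - R₁))
    exact ⟨mul_nonneg h1.1 h2.1, by nlinarith [h1.1, h1.2, h2.1, h2.2]⟩
  have hψ_in0 : ∀ ρ, ρ ≤ u₀ / 2 → ψ ρ = 0 := fun ρ hρ => by
    have : max 0 ((2 * ρ - u₀) / u₀) = 0 := max_eq_left (div_nonpos_of_nonpos_of_nonneg (by linarith) hu₀.le)
    simp only [hψ, this, min_eq_right (zero_le_one : (0 : ℝ) ≤ 1), zero_mul]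
  have hψ_out0 : ∀ ρ, R₂ ≤ ρ → ψ ρ = 0 := fun ρ hρ => by
    have : max 0 ((R₂ - ρ) / (R₂ - R₁)) = 0 := max_eq_left (div_nonpos_of_nonpos_of_nonneg (by linarith) hR0.le)
    simp only [hψ, this, min_eq_right (zero_le_one : (0 : ℝ) ≤ 1), mul_zero]
  have hψ_one : ∀ ρ, u₀ ≤ ρ → ρ ≤ R₁ → ψ ρ = 1 := fun ρ h1 h2 => by
    have e1 : min 1 (max 0 ((2 * ρ - u₀) / u₀)) = 1 := by
      refine min_eq_left ?_
      exact le_max_of_le_right (by rw [le_div_iff₀ hu₀]; linarith)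
    have e2 : min 1 (max 0 ((R₂ - ρ) / (R₂ - R₁))) = 1 := by
      refine min_eq_left ?_
      exact le_max_of_le_right (by rw [le_div_iff₀ hR0]; linarith)
    simp only [hψ, e1, e2, mul_one]
  have hψlip : ∀ ρ ρ', |ψ ρ - ψ ρ'| ≤ (2 / u₀ + 1 / (R₂ - R₁)) * |ρ - ρ'| := by
    intro ρ ρ'
    have h1 := klpw_clamp_sub_le ((2 * ρ - u₀) / u₀) ((2 * ρ' - u₀) / u₀)
    have h2 := klpw_clamp_sub_le ((R₂ - ρ) / (R₂ - R₁)) ((R₂ - ρ') / (R₂ - R₁))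
    have e1 : |(2 * ρ - u₀) / u₀ - (2 * ρ' - u₀) / u₀| = 2 / u₀ * |ρ - ρ'| := by
      rw [← sub_div, abs_div, abs_of_pos hu₀, show 2 * ρ - u₀ - (2 * ρ' - u₀) = 2 * (ρ - ρ') by ring, abs_mul, abs_two]; ring
    have e2 : |(R₂ - ρ) / (R₂ - R₁) - (R₂ - ρ') / (R₂ - R₁)| = 1 / (R₂ - R₁) * |ρ - ρ'| := by
      rw [← sub_div, abs_div, abs_of_pos hR0, show R₂ - ρ - (R₂ - ρ') = -(ρ - ρ') by ring, abs_neg]; ring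
    rw [e1] at h1; rw [e2] at h2
    set a₁ := min 1 (max 0 ((2 * ρ - u₀) / u₀)); set a₂ := min 1 (max 0 ((2 * ρ' - u₀) / u₀))
    set b₁ := min 1 (max 0 ((R₂ - ρ) / (R₂ - R₁))); set b₂ := min 1 (max 0 ((R₂ - ρ') / (R₂ - R₁)))
    have ha₁ := klpw_clamp_mem ((2 * ρ - u₀) / u₀); have hb₂ := klpw_clamp_mem ((R₂ - ρ') / (R₂ - R₁))
    have e : a₁ * b₁ - a₂ * b₂ = a₁ * (b₁ - b₂) + (a₁ - a₂) * b₂ := by ring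
    simp only [hψ]
    rw [e]
    calc |a₁ * (b₁ - b₂) + (a₁ - a₂) * b₂| ≤ |a₁| * |b₁ - b₂| + |a₁ - a₂| * |b₂| := by
          refine (abs_add_le _ _).trans ?_; rw [abs_mul, abs_mul]
      _ ≤ 1 * (1 / (R₂ - R₁) * |ρ - ρ'|) + 2 / u₀ * |ρ - ρ'| * 1 := by
          refine add_le_add (mul_le_mul ?_ h2 (abs_nonneg _) zero_le_one) (mul_le_mul h1 ?_ (abs_nonneg _) (by positivity))
          · rw [abs_of_nonneg ha₁.1]; exact ha₁.2
          · rw [abs_of_nonneg hb₂.1]; exact hb₂.2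
      _ = (2 / u₀ + 1 / (R₂ - R₁)) * |ρ - ρ'| := by ring
  -- the raw weight: bound, support, Lipschitz
  have hgb : ∀ q, |g q| ≤ BV := fun q => by
    simp only [hg, abs_mul]
    have := hψ01 ‖zc q‖
    rw [abs_of_nonneg this.1]
    calc |V (Complex.arg (zc q))| * ψ ‖zc q‖ ≤ BV * 1 := mul_le_mul (hVbd _) this.2 this.1 hBV
      _ = BV := mul_one _
  have hg0_small : ∀ q, ‖zc q‖ ≤ u₀ / 2 → g q = 0 := fun q hq => by simp only [hg, hψ_in0 _ hq, mul_zero]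
  have hg0_bdry : ∀ q : ℝ × ℝ, (π - (π - R₂) ≤ |q.1| ∨ π - (π - R₂) ≤ |q.2|) → g q = 0 := by
    intro q hq
    have hnorm : R₂ ≤ ‖zc q‖ := by
      rcases hq with h | h
      · exact (by linarith : R₂ ≤ |q.1|).trans (klpw_abs_fst_le_norm q.1 q.2)
      · have h' : |q.2| ≤ ‖zc q‖ := by
          have := Complex.abs_im_le_norm ((q.1 : ℂ) + (q.2 : ℂ) * Complex.I)
          rwa [(klpw_zc_re_im q.1 q.2).2] at this
        exact (by linarith : R₂ ≤ |q.2|).trans h'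
    simp only [hg, hψ_out0 _ hnorm, mul_zero]
  set Lg : ℝ := 2 * (LV * (π / (u₀ / 2)) + BV * (2 / u₀ + 1 / (R₂ - R₁))) with hLg
  have hLg0 : 0 ≤ Lg := by positivity
  have hglip : ∀ p q : ℝ × ℝ, |g p - g q| ≤ Lg * dist p q := by
    -- the one-sided vanishing estimate near the origin
    have hnear : ∀ p q : ℝ × ℝ, ‖zc p‖ ≤ u₀ / 2 → |g p - g q| ≤ Lg * dist p q := by
      intro p q hp
      rw [hg0_small p hp, zero_sub, abs_neg]
      rcases le_or_gt ‖zc q‖ (u₀ / 2) with hq | hq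
      · rw [hg0_small q hq, abs_zero]; positivity
      · -- `|g q| ≤ BV·ψ(‖q‖) ≤ BV·(2/u₀ + 1/(R₂−R₁))·(‖q‖ − ‖p‖)`
        have hψq : ψ ‖zc q‖ ≤ (2 / u₀ + 1 / (R₂ - R₁)) * (‖zc q‖ - ‖zc p‖) := by
          have h := hψlip ‖zc q‖ ‖zc p‖
          rw [hψ_in0 _ hp, sub_zero, abs_of_nonneg (hψ01 _).1, abs_of_nonneg (by linarith : 0 ≤ ‖zc q‖ - ‖zc p‖)] at h
          exact h
        have hdz : ‖zc q‖ - ‖zc p‖ ≤ 2 * dist p q := by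
          have := norm_sub_norm_le (zc q) (zc p)
          have h2 := klpw_norm_zc_sub_le q p
          rw [dist_comm] at h2
          simp only [hzc] at this h2 ⊢
          linarith
        simp only [hg, abs_mul, abs_of_nonneg (hψ01 ‖zc q‖).1]
        calc |V (Complex.arg (zc q))| * ψ ‖zc q‖ ≤ BV * ((2 / u₀ + 1 / (R₂ - R₁)) * (2 * dist p q)) :=
              mul_le_mul (hVbd _) (hψq.trans (mul_le_mul_of_nonneg_left hdz (by positivity))) (hψ01 _).1 hBV
          _ ≤ Lg * dist p q := by
              rw [hLg]
              have hd : 0 ≤ dist p q := dist_nonneg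
              nlinarith [mul_nonneg hLV (by positivity : (0 : ℝ) ≤ π / (u₀ / 2)), mul_nonneg hd (mul_nonneg hLV (by positivity : (0 : ℝ) ≤ π / (u₀ / 2)))]
    intro p q
    rcases le_or_gt ‖zc p‖ (u₀ / 2) with hp | hp
    · exact hnear p q hp
    rcases le_or_gt ‖zc q‖ (u₀ / 2) with hq | hq
    · rw [abs_sub_comm, dist_comm]; exact hnear q p hq
    -- both away from the origin
    have hVd := klpw_abs_comp_arg_sub_le V hV hLV hVlip (by positivity : (0 : ℝ) < u₀ / 2) hp.le hq.le
    have hψd := hψlip ‖zc p‖ ‖zc q‖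
    have hdz : ‖zc p - zc q‖ ≤ 2 * dist p q := klpw_norm_zc_sub_le p q
    have hdn : |‖zc p‖ - ‖zc q‖| ≤ 2 * dist p q := (abs_norm_sub_norm_le _ _).trans hdz
    have e : g p - g q = (V (Complex.arg (zc p)) - V (Complex.arg (zc q))) * ψ ‖zc p‖ + V (Complex.arg (zc q)) * (ψ ‖zc p‖ - ψ ‖zc q‖) := by
      simp only [hg]; ring
    rw [e]
    calc |(V (Complex.arg (zc p)) - V (Complex.arg (zc q))) * ψ ‖zc p‖ + V (Complex.arg (zc q)) * (ψ ‖zc p‖ - ψ ‖zc q‖)|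
        ≤ |V (Complex.arg (zc p)) - V (Complex.arg (zc q))| * |ψ ‖zc p‖| + |V (Complex.arg (zc q))| * |ψ ‖zc p‖ - ψ ‖zc q‖| := by
          have h := abs_add_le ((V (Complex.arg (zc p)) - V (Complex.arg (zc q))) * ψ ‖zc p‖) (V (Complex.arg (zc q)) * (ψ ‖zc p‖ - ψ ‖zc q‖))
          have h1 : |(V (Complex.arg (zc p)) - V (Complex.arg (zc q))) * ψ ‖zc p‖| = |V (Complex.arg (zc p)) - V (Complex.arg (zc q))| * |ψ ‖zc p‖| :=
            abs_mul _ _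
          have h2 : |V (Complex.arg (zc q)) * (ψ ‖zc p‖ - ψ ‖zc q‖)| = |V (Complex.arg (zc q))| * |ψ ‖zc p‖ - ψ ‖zc q‖| := abs_mul _ _
          linarith
      _ ≤ LV * (π / (u₀ / 2)) * (2 * dist p q) * 1 + BV * ((2 / u₀ + 1 / (R₂ - R₁)) * (2 * dist p q)) := by
          refine add_le_add (mul_le_mul (hVd.trans ?_) ?_ (abs_nonneg _) (by positivity)) (mul_le_mul (hVbd _) (hψd.trans ?_) (abs_nonneg _) hBV)
          · exact mul_le_mul_of_nonneg_left hdz (by positivity)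
          · rw [abs_of_nonneg (hψ01 _).1]; exact (hψ01 _).2
          · exact mul_le_mul_of_nonneg_left hdn (by positivity)
      _ = Lg * dist p q := by rw [hLg]; ring
  have hgcont : Continuous g := by
    have hL : LipschitzWith (Real.toNNReal Lg) g := LipschitzWith.of_dist_le_mul fun p q => by
      rw [Real.dist_eq, Real.coe_toNNReal _ hLg0]; exact hglip p q
    exact hL.continuous
  -- the periodization
  refine ⟨klfl_periodize g, klfl_periodize_continuous hzm hg0_bdry hgcont (by linarith), fun x y => klfl_periodize_add_fst g x y,
    fun x y => klfl_periodize_add_snd g x y, fun p q => ?_, fun p => ?_, fun p hp => ?_⟩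
  · -- Lipschitz
    have h := klfl_periodize_lipschitz hzm hg0_bdry hLg0 (fun q => by rw [Real.norm_eq_abs]; exact hgb q)
      (fun p _ q _ => by rw [Real.norm_eq_abs]; exact hglip p q) (by linarith) p q
    rw [Real.norm_eq_abs] at h
    convert h using 2
  · -- bound
    have h := klfl_periodize_norm_le (g := g) (fun q => by rw [Real.norm_eq_abs]; exact hgb q) p
    rwa [Real.norm_eq_abs] at h
  · -- radial constancy on the chart tube
    have hu : 0 < perturbedFermiRadius (fun k : Fin 2 → ℝ => -K.eval k) (μ + p.1) p.2 := levelRadius_pos B hA (by linarith [hp.1]) (by linarith [hp.2]) p.2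
    obtain ⟨hulo, huhi⟩ := hrad p hp
    have hnorm := klpw_norm_zc_levelChart (μ := μ) (K := K) p hu
    -- the chart point lies in the closed square
    have hsq : levelChart μ K p ∈ Icc (-π) π ×ˢ Icc (-π) π := by
      have h1 : |(levelChart μ K p).1| ≤ R₁ := (klpw_abs_fst_le_norm _ _).trans (by rw [hnorm]; exact huhi)
      have h2 : |(levelChart μ K p).2| ≤ R₁ := by
        have := Complex.abs_im_le_norm ((((levelChart μ K p).1 : ℝ) : ℂ) + (((levelChart μ K p).2 : ℝ) : ℂ) * Complex.I)
        rw [(klpw_zc_re_im _ _).2, hnorm] at this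
        exact this.trans huhi
      exact ⟨⟨by linarith [(abs_le.1 h1).1], by linarith [(abs_le.1 h1).2]⟩, ⟨by linarith [(abs_le.1 h2).1], by linarith [(abs_le.1 h2).2]⟩⟩
    rw [klfl_periodize_eq_of_mem hzm hg0_bdry hsq]
    have hψ1 : ∀ p' : ℝ × ℝ, p'.1 ∈ Ioo (-r) r → (fun q : ℝ × ℝ => ψ ‖zc q‖) (levelChart μ K p') = 1 := by
      intro p' hp'
      have hu' : 0 < perturbedFermiRadius (fun k : Fin 2 → ℝ => -K.eval k) (μ + p'.1) p'.2 :=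
        levelRadius_pos B hA (by linarith [hp'.1]) (by linarith [hp'.2]) p'.2
      simp only [hzc]
      rw [klpw_norm_zc_levelChart (μ := μ) (K := K) p' hu']
      exact hψ_one _ (hrad p' hp').1 (hrad p' hp').2
    have h := klpw_radialConstancy_of_arg B hA hlo hhi V hV (fun q : ℝ × ℝ => ψ ‖zc q‖) hψ1 hp
    simp only [hg, hzc] at h ⊢
    exact h

end Extension

end Summit.HubbardSuperconductivity.HubbardSuperconductivity.Theorems.KLRegimeSplit

end
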